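import Literature.AnabelianGeometry.EtaleTheta.Discharge.Sec5SectionLawsAtThetaSettingYdd
import Literature.AnabelianGeometry.EtaleTheta.Discharge.Sec5Lem59iIffProp43iii
import Literature.AnabelianGeometry.EtaleTheta.Discharge.Sec5Prop52iiSectionDefinedActions

/-!
# [EtTh] Lemma 1.2 p.245 (PDF p.19) AT THE §5 READING, per level: the `τ_N`-preserving action exists uniquely in `C` and
# differs from the `s_N`-action by `μ_N(B_N)`-values — at the §5 data OF THE SETTING (`A_⊙^bs := Ÿ̲̲`), NO hypothesis beyond the data

S. Mochizuki, *The étale theta function and its Frobenioid-theoretic manifestations*, Publ. RIMS **45** (2009), Lemma 1.2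
p.245 (PDF p.19 ll.52–81): "(a) By modifying the various `τ_N` by suitable `O^×_{J̈_N}`-multiples, one may assume that
`τ_{N₁}^{⊗N₁/N₂} = τ_{N₂}` … (b) there exists a compatible system [as `N` varies over the positive integers] of actions of
`Π^tp_Y` (respectively, `Π^tp_Ÿ`) on `Ÿ_N`, `V(L̈_N)` which preserve `τ_N`. (c) Finally, each action of this system differs from
the action determined by the action of Proposition 1.1, (ii), by multiplication by a(n) `2N`-th root of unity (respectively,
`N`-th root of unity)." — read through Prop. 5.2 (ii) p.324 (PDF p.98): the pull-backs of `s_{l·N}`, `τ_{l·N}` "may be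
interpreted as morphisms `V(O_{Z̈_{l·N}}) → V(L̈_{l·N}|_{Z̈_{l·N}})` — i.e., as morphisms between objects of `C`" (`s^⊓_N`, `s^⊔_N`),
and "the group actions of Proposition 1.1, (ii); Lemma 1.2 … are precisely the actions determined by the bi-Kummer
`l·N`-th root"; §5 p.331 (PDF p.105) (`s^⊓-gp_N`, `s^⊔-gp_N`); Prop. 4.3 (iii) p.317 (PDF p.91).
[cite: MochizukiEtTh2009, Lem 1.2 p.245 (PDF p.19); Prop 5.2 (ii) p.324 (PDF p.98); §5 p.331 (PDF p.105)]

abc-iut cell, layer L2 = [EtTh], seat abc-iut-w6-d054 (gen 7), abc-iut-L2-lead ROWS #128 R958 «LEM12 COUNT CENSUS», reading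
(β) «COUNT at the §5 reading, per level».  The cone node `EtTh:Lem1.2` is keyed to abc-iut-L2-t1's carrier-less predicate
`ThetaSetting.Lem12 (L : D.LineBundleData)` (`ThetaTrivializations.lean`; formal schemes have no carrier, plan/FOUNDATIONS.md
row 14; only the toy `LineBundleData` exists, `lem12_toy`; ∀-closure refuted, `not_forall_lem12`).  THIS FILE records, under
ONE name per sentence, what the tree PROVES of Lemma 1.2 at the §5 reading at the GENUINE §5 data of the §1 setting
(`ThetaFrobenioid.ofThetaSettingData` over `BiKummerSetting.mkOfThetaSettingYdd`, `A_⊙^bs := Ÿ̲̲`; abc-iut-L2-t4 /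
abc-iut-w6-d053): PROOF-ONLY (no `def`, no instance, no `Prop`-valued definition, no notation); everything BY NAME —
abc-iut-L2-t4's `existsUnique_action_compatible_sCup_of_totallyEpi` (p489004), `epi_of_model` ([FrdI] Thm. 5.2), abc-iut-w6-d053's
`exists_sgpCup_eq_muTorsion_mul_sgpCap` (`Sec5Lem59iIffProp43iii.lean`),
`sgpCupSpec_ofThetaSettingYddData` / `biKummerDifferenceMem_ofThetaSettingYddData` / `enExact_ofThetaSettingYddData`
(abc-iut-w6-d053, over this seat's `…_ofConnectedTemperoidYddData`); nothing landed is edited or restated.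

* (L12-b) `lem12b_existsUnique_tauAction_ofThetaSettingYddData` — EXACTLY ONE action `H_{B_N} → Aut_C(B_N)` is compatible with
  the morphism `s^⊔_N` determined by `τ_{l·N}` ("actions … which preserve `τ_N`"), namely `s^⊔-gp_N`;
* (L12-c) `lem12c_tauAction_eq_mu_mul_sAction_ofThetaSettingYddData` — for every `h ∈ H_{B_N}`,
  `s^⊔-gp_N(h) = ζ_h · s^⊓-gp_N(h)` with `ζ_h ∈ μ_N(B_N)` ("differs from the action determined by … Proposition 1.1, (ii), by
  multiplication by a … root of unity"; the §5 typing carries ONE torsion group `μ_N(B_N)` over `H_{B_N}` — print's finer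
  `2N`-vs-`N` split along the double cover `Ÿ → Y` is not separately typed in §5);
* `lem12_section5Reading_ofThetaSettingYddData` — the per-level conjunction (b) ∧ (c) ∧ [EtTh] Lem. 5.9 (ii) exactness of
  `1 → μ_N(B_N) → E_N → Im → 1` (the group in which both actions live).
NOT here (honest): sentence (a) and the «compatible system [as `N` varies]» clause of (b) are CROSS-LEVEL laws of the genuine
§5 tower (Rmk. 4.3.2 `β_{N,N′}`; `ThetaFrobenioidTower`) = GAP-LEDGER G-L2d4-3 parts (hdesc)/(hθ₁), OPEN; no per-level surrogate
is claimed.  HONEST FRAMING: a READING of a §1 statement at §5 data the tree constructs (`tf` an abstract tempered-Frobenioid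
parameter); nothing of [EtTh] §1's formal schemes is modelled; nothing here bears on [IUTchIII] Cor. 3.12; no side taken;
typed ≠ proved.
-/

noncomputable section

namespace Literature.AnabelianGeometry.EtaleTheta

open CategoryTheory Opposite Literature.AlgebraicGeometry.Frobenioids Literature.AnabelianGeometry.SemiGraphs

universe u v u' v' w v₀

namespace ThetaFrobenioid

/-! ### Generic: sentence (c) IS `BiKummerDifferenceMem` (element form = abc-iut-w6-d053's `exists_sgpCup_eq_muTorsion_mul_sgpCap`) -/

section Generic

variable {C : Type u} [Category.{v} C] {D : Type u'} [Category.{v'} D] (𝔉 : ThetaFrobenioid.{w} C D)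

/-- **Lem. 1.2 sentence (c) read in `C` ⟺ Prop. 4.3 (iii)**: the factorisation `s^⊔-gp_N(h) = ζ_h · s^⊓-gp_N(h)` with
`ζ_h ∈ μ_N(B_N)` for every `h ∈ H_{B_N}` ("each action … differs from the action determined by … Proposition 1.1, (ii), by
multiplication by a … root of unity") IS the typed bi-Kummer cocycle fact `BiKummerDifferenceMem`; the forward direction is
abc-iut-w6-d053's element form `exists_sgpCup_eq_muTorsion_mul_sgpCap` (cited, not restated).
[cite: MochizukiEtTh2009, Lem 1.2 p.245 (PDF p.19); Prop 4.3 (iii) p.317 (PDF p.91)] -/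
theorem biKummerDifferenceMem_iff_exists_mu_mul :
    𝔉.BiKummerDifferenceMem ↔
      ∀ h : 𝔉.HB, ∃ ζ ∈ 𝔉.muTorsion 𝔉.BN 𝔉.N, 𝔉.sgpCup h = ζ * 𝔉.sgpCap (h : Aut (𝔉.base.obj 𝔉.BN)) := by
  refine ⟨fun hdiff h => 𝔉.exists_sgpCup_eq_muTorsion_mul_sgpCap hdiff h, fun H h => ?_⟩
  obtain ⟨ζ, hζ, hh⟩ := H h
  rw [hh, mul_inv_cancel_right]
  exact hζ

end Generic

/-! ### At the §5 data OF THE §1 SETTING (`ofThetaSettingData` over `mkOfThetaSettingYdd`, `A_⊙^bs := Ÿ̲̲`) -/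

section OfThetaSettingYddData

variable {p : ℕ} [Fact p.Prime] {D : ThetaSetting p} {E : D.EtaleThetaData} {l : ℕ} {C : E.DoubleUnderline l}
  {e : D.toTemperedCurve.GroupLevelData} {N : ℕ+} (μ : D.CyclotomeMod l N) (hC : D.Compat) (hS : D.Sec2Hyps)
  {D₀ : Type} [Category.{v₀} D₀] {V : FrdIMonoidStub.{0}} {T₀ : RealifiedDivisorMonoids (D₀ := D₀) V}
  {VD : FrdICatStub.{1, 0, 0} (ConnectedPart (BTemp (C.temperedArithmeticGroup e).Pi))}
  {tf : TemperedFrobenioid T₀ (ConnectedPart (BTemp (C.temperedArithmeticGroup e).Pi)) VD} {hZ : tf.monoidType = MonoidType.Z}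
  {hP : ∀ A : (ConnectedPart (BTemp (C.temperedArithmeticGroup e).Pi))ᵒᵖ, IsPerfect (tf.Φ.carrier A)}
  {NH : Subgroup (Field.absoluteGaloisGroup D.K) → tf.category → ℕ+ → Prop}
  {pullFrac : ∀ {A A' : (BiKummerSetting.mkOfThetaSettingYdd C e μ hC hS tf hZ hP NH).C} (_ : A' ⟶ A),
    (BiKummerSetting.mkOfThetaSettingYdd C e μ hC hS tf hZ hP NH).biratUnits A →
      (BiKummerSetting.mkOfThetaSettingYdd C e μ hC hS tf hZ hP NH).biratUnits A'}
  {θ : (BiKummerSetting.mkOfThetaSettingYdd C e μ hC hS tf hZ hP NH).biratUnits (BiKummerSetting.mkOfThetaSettingYdd C e μ hC hS tf hZ hP NH).Aodot}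
  {Bl : (BiKummerSetting.mkOfThetaSettingYdd C e μ hC hS tf hZ hP NH).C}
  {Pl : (BiKummerSetting.mkOfThetaSettingYdd C e μ hC hS tf hZ hP NH).FractionPair θ Bl}
  {Rl : (BiKummerSetting.mkOfThetaSettingYdd C e μ hC hS tf hZ hP NH).NthRoot θ Pl C.lPNat pullFrac}
  (h : ModelFrobenioid.Hypotheses tf.divisorMonoid tf.ratFnFunctor)
  (Q : FrobenioidTheta.ThetaSubquotientStub.{0} (ConnectedPart (BTemp (C.temperedArithmeticGroup e).Pi)))
  (R : (BiKummerSetting.mkOfThetaSettingYdd C e μ hC hS tf hZ hP NH).NthRoot Rl.root Rl.pair N pullFrac)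
  (K' : Type) [Field K'] (constEmb : K'ˣ →* tf.biratUnitsModel R.BN) (constEmb_injective : Function.Injective constEmb)
  (hinvc : ∀ g : Aut R.AN.base,
    pull tf.divisorMonoid g.hom (ModelFrobenioid.div R.pair.num) = ModelFrobenioid.div R.pair.num)
  (hinvp : ∀ y : (C.thetaEnvData μ hC hS).PiX, y ∈ (C.thetaEnvData μ hC hS).PiYdd →
    pull tf.divisorMonoid ((BiKummerSetting.mkOfThetaSettingYdd C e μ hC hS tf hZ hP NH).galoisSurj
      R.AN.base R.αData.isGalois ((ContinuousMulEquiv.refl _) y)).hom (ModelFrobenioid.div R.pair.den) = ModelFrobenioid.div R.pair.den)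

/-- **Lem. 1.2 sentence (b) at the §5 reading, at the §5 data of the Setting (`A_⊙^bs := Ÿ̲̲`), NO hypothesis beyond the data**:
there is EXACTLY ONE action `H_{B_N} → Aut_C(B_N)` compatible (over `s^trv_N`) with the morphism `s^⊔_N` determined by `τ_{l·N}`
— "actions of `Π^tp_Ÿ` on `Ÿ_N`, `V(L̈_N)` which preserve `τ_N`" — namely `s^⊔-gp_N` (abc-iut-L2-t4's
`existsUnique_action_compatible_sCup_of_totallyEpi`, total epimorphicity = [FrdI] Thm. 5.2 `epi_of_model`, the defining relation =
`sgpCupSpec_ofThetaSettingYddData`). [cite: MochizukiEtTh2009, Lem 1.2 p.245 (PDF p.19); Prop 5.2 (ii) p.324 (PDF p.98); §5 p.331 (PDF p.105)] -/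
theorem lem12b_existsUnique_tauAction_ofThetaSettingYddData :
    ∃! b : (ofThetaSettingData μ hC hS h Q R K' constEmb constEmb_injective hinvc hinvp).HB →*
        Aut (ofThetaSettingData μ hC hS h Q R K' constEmb constEmb_injective hinvc hinvp).BN,
      ∀ hh : (ofThetaSettingData μ hC hS h Q R K' constEmb constEmb_injective hinvc hinvp).HB,
        (ofThetaSettingData μ hC hS h Q R K' constEmb constEmb_injective hinvc hinvp).sCup ≫ (b hh).hom =
          ((ofThetaSettingData μ hC hS h Q R K' constEmb constEmb_injective hinvc hinvp).strv
            ((ofThetaSettingData μ hC hS h Q R K' constEmb constEmb_injective hinvc hinvp).autBaseIsoAB.symm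
              (hh : Aut ((ofThetaSettingData μ hC hS h Q R K' constEmb constEmb_injective hinvc hinvp).base.obj
                (ofThetaSettingData μ hC hS h Q R K' constEmb constEmb_injective hinvc hinvp).BN)))).hom ≫
            (ofThetaSettingData μ hC hS h Q R K' constEmb constEmb_injective hinvc hinvp).sCup :=
  existsUnique_action_compatible_sCup_of_totallyEpi _ (epi_of_model (DivB := tf.divBNatTrans) h)
    (sgpCupSpec_ofThetaSettingYddData μ hC hS h Q R K' constEmb constEmb_injective hinvc hinvp)

/-- **Lem. 1.2 sentence (c) at the §5 reading, at the §5 data of the Setting (`A_⊙^bs := Ÿ̲̲`), NO hypothesis beyond the data**: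
for every `h ∈ H_{B_N}` the `τ`-action `s^⊔-gp_N(h)` equals `ζ_h · s^⊓-gp_N(h)` with `ζ_h ∈ μ_N(B_N)` (abc-iut-w6-d053's
`biKummerDifferenceMem_ofThetaSettingYddData` over this seat's `biKummerDifferenceMem_ofConnectedTemperoidYddData`).
[cite: MochizukiEtTh2009, Lem 1.2 p.245 (PDF p.19); Prop 4.3 (iii) p.317 (PDF p.91); §5 p.331 (PDF p.105)] -/
theorem lem12c_tauAction_eq_mu_mul_sAction_ofThetaSettingYddData
    (hh : (ofThetaSettingData μ hC hS h Q R K' constEmb constEmb_injective hinvc hinvp).HB) :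
    ∃ ζ ∈ (ofThetaSettingData μ hC hS h Q R K' constEmb constEmb_injective hinvc hinvp).muTorsion
        (ofThetaSettingData μ hC hS h Q R K' constEmb constEmb_injective hinvc hinvp).BN
        (ofThetaSettingData μ hC hS h Q R K' constEmb constEmb_injective hinvc hinvp).N,
      (ofThetaSettingData μ hC hS h Q R K' constEmb constEmb_injective hinvc hinvp).sgpCup hh =
        ζ * (ofThetaSettingData μ hC hS h Q R K' constEmb constEmb_injective hinvc hinvp).sgpCap
          (hh : Aut ((ofThetaSettingData μ hC hS h Q R K' constEmb constEmb_injective hinvc hinvp).base.obj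
            (ofThetaSettingData μ hC hS h Q R K' constEmb constEmb_injective hinvc hinvp).BN)) :=
  exists_sgpCup_eq_muTorsion_mul_sgpCap _
    (biKummerDifferenceMem_ofThetaSettingYddData μ hC hS h Q R K' constEmb constEmb_injective hinvc hinvp) hh

/-- **[EtTh] Lemma 1.2 at the §5 reading, PER LEVEL, at the §5 data OF THE §1 SETTING (`A_⊙^bs := Ÿ̲̲`) — NO hypothesis beyond
the data**: (b) the `τ_N`-preserving action of `H_{B_N}` exists uniquely in `C` ∧ (c) it differs from the `s_N`-action by
`μ_N(B_N)`-values ∧ (Lem. 5.9 (ii)) both live in the extension `1 → μ_N(B_N) → E_N → Im → 1`, which is exact (`ENExact`,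
abc-iut-w6-d053's `enExact_ofThetaSettingYddData`).  The cross-level sentence (a) / «compatible system [as `N` varies]» is NOT
included (tower law, GAP-LEDGER G-L2d4-3). [cite: MochizukiEtTh2009, Lem 1.2 p.245 (PDF p.19); Prop 5.2 (ii) p.324 (PDF p.98); Lem 5.9 (ii) p.332 (PDF p.106)] -/
theorem lem12_section5Reading_ofThetaSettingYddData :
    (∃! b : (ofThetaSettingData μ hC hS h Q R K' constEmb constEmb_injective hinvc hinvp).HB →*
        Aut (ofThetaSettingData μ hC hS h Q R K' constEmb constEmb_injective hinvc hinvp).BN,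
      ∀ hh : (ofThetaSettingData μ hC hS h Q R K' constEmb constEmb_injective hinvc hinvp).HB,
        (ofThetaSettingData μ hC hS h Q R K' constEmb constEmb_injective hinvc hinvp).sCup ≫ (b hh).hom =
          ((ofThetaSettingData μ hC hS h Q R K' constEmb constEmb_injective hinvc hinvp).strv
            ((ofThetaSettingData μ hC hS h Q R K' constEmb constEmb_injective hinvc hinvp).autBaseIsoAB.symm
              (hh : Aut ((ofThetaSettingData μ hC hS h Q R K' constEmb constEmb_injective hinvc hinvp).base.obj
                (ofThetaSettingData μ hC hS h Q R K' constEmb constEmb_injective hinvc hinvp).BN)))).hom ≫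
            (ofThetaSettingData μ hC hS h Q R K' constEmb constEmb_injective hinvc hinvp).sCup) ∧
    (∀ hh : (ofThetaSettingData μ hC hS h Q R K' constEmb constEmb_injective hinvc hinvp).HB,
      ∃ ζ ∈ (ofThetaSettingData μ hC hS h Q R K' constEmb constEmb_injective hinvc hinvp).muTorsion
          (ofThetaSettingData μ hC hS h Q R K' constEmb constEmb_injective hinvc hinvp).BN
          (ofThetaSettingData μ hC hS h Q R K' constEmb constEmb_injective hinvc hinvp).N,
        (ofThetaSettingData μ hC hS h Q R K' constEmb constEmb_injective hinvc hinvp).sgpCup hh =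
          ζ * (ofThetaSettingData μ hC hS h Q R K' constEmb constEmb_injective hinvc hinvp).sgpCap
            (hh : Aut ((ofThetaSettingData μ hC hS h Q R K' constEmb constEmb_injective hinvc hinvp).base.obj
              (ofThetaSettingData μ hC hS h Q R K' constEmb constEmb_injective hinvc hinvp).BN))) ∧
    (ofThetaSettingData μ hC hS h Q R K' constEmb constEmb_injective hinvc hinvp).ENExact :=
  ⟨lem12b_existsUnique_tauAction_ofThetaSettingYddData μ hC hS h Q R K' constEmb constEmb_injective hinvc hinvp,
    lem12c_tauAction_eq_mu_mul_sAction_ofThetaSettingYddData μ hC hS h Q R K' constEmb constEmb_injective hinvc hinvp,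
    enExact_ofThetaSettingYddData μ hC hS h Q R K' constEmb constEmb_injective hinvc hinvp⟩

end OfThetaSettingYddData

end ThetaFrobenioid

end Literature.AnabelianGeometry.EtaleTheta

end
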